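import Summits.BirchSwinnertonDyer.BirchSwinnertonDyer.Theorems.OneSidedTwistSqueezeX9KatoDivisibilityX9GradedCoreAssembly
import HarnessLib

set_option autoImplicit false

-- the summit and its single problem are both named `BirchSwinnertonDyer` (registry layout D-0017)
set_option linter.dupNamespace false

/-!
# The GRADED core assembly WITH BOUNDED DEFECT: `SIM.FineCoreGradedOddPrime` from FOUR graded stubs
# (test-pair supply / level-`L` test cocycle / defect-tolerant Kolyvagin prime / reciprocity over `A`) —
# skeleton v4 of line `graded_euler_loss` (crux `KatoDivisibilityX9` = stmt-BirchSwinnertonDyer-20547)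

Seat `bsd-line-k6-p4` (prover-bsd-line-k6-p4-g5-0, 5th LEAD).  THEOREMS ONLY, sorry-free, no definition; the four graded
statements enter as HYPOTHESES (`--supports stmt-BirchSwinnertonDyer-20547 --as helper`).  This is the RESHAPE of the
landed assembly `…GradedCoreAssembly.fineCoreGraded_of_testCocycle_of_kolyvaginPrime_of_reciprocity` (p621747, skeleton
v3) forced by the g5 wave-1 verdict on STUB 1a (`stub_testCocyclePkX9` MIS-STATED, evidence
`…StubTestCocyclePkX9Obstruction.lean` p626333): under the level-`p^{d+1}` dictionary
`H¹(ℚ, 𝒯^{(d+1)}_{J+1}(κ⁻¹)) ≅ H¹(ℚ_∞, E[p^{d+1}])[(conj_γ − 1)^{J+1}]`, a test class AT LEVEL `J+1` whose `p^d`-multiple has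
`T`-order `> J` is an EXACT test pair, and the dual fine Selmer shape `X₀ ≅ (p,T)·Λ/p²` has none (while v3's hypothesis holds
at every `J`).  REPAIR (same composition idea, one more stub):
* `hBD` — TEST-PAIR SUPPLY WITH BOUNDED DEFECT: a constant `δ₀` (for the pair, `n`, `d ≤ n`) such that whenever some
  `E[p]`-class `y` with image in `p^n·Sel₀` has `T^J y ≠ 0`, there is one with image `p^d·t`, `T^J y ≠ 0` AND
  `T^{J+1+δ₀} t = 0` (Artin–Rees for `(T)` on the finitely generated `Λ/p^{d+1}`-module `X₀/p^{d+1}X₀` + Nakayama, read through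
  Pontryagin duality);
* `hG1` — the test cocycle at an honest LEVEL `L ≥ J+1` with `T^L t = 0` (the g5 worker's corrected statement, levels decoupled):
  `Ψ ∈ H¹(ℚ, 𝒯^{(d+1)}_L(κ⁻¹))`, `ψ̄` at level `L`, `p^dΨ = ι_*ψ̄`, `T^J ψ̄ ≠ 0`, unramified off `S`, `T^ε`-locally trivial on `S`;
* `h12` — the Kolyvagin prime for a test class of DEFECT `δ`: hypothesis `T^{e−1−δ}ψ ≠ 0` instead of `T^{e−1}ψ ≠ 0`, constants
  `c₀, N₁` depending on `δ` (the landed stub 1b p626585 is the case `δ = 0`; its method — defect levels — covers every `δ`);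
* `hG34` — reciprocity over `A = Λ/(p^{d+1}, ω²)`: v3's statement with the (unused at `d = 0`) fullness hypothesis on `ψ̄` DROPPED.
Proof = p621747's with the bad class taken at `T`-order `J₀ = Jb − δ₀` and re-supplied by `hBD` with a partner killed by
`T^{Jb+1}`, `Jb + 1 = 2e(d+1)`; the truncations to levels `2e`, `e` then have defect `δ₀`
(`GradedCoreAlgebra.shiftH1_iterate_truncate_ne_zero_of_le` twice); `N` absorbs `δ₀`.

HONEST LABEL: the four graded statements are OPEN (typed over tree declarations only); nothing is proved about them here;
`SIM.FineCoreGradedOddPrime` (hence ES-C4) follows from them by this file; crux 20547 / B2 untouched; beyond-print theorem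
toward BSD: NO; BSD is not proved by any of this; no summit statement is proved by this seat.

References: K. Kato, Astérisque 295 (2004) §13.3, §13.8, Thm. 12.4, Thm. 13.4 [Kato2004Asterisque]; B. Mazur, K. Rubin,
Mem. AMS 799 (2004) Prop. 1.3.2, §4.4, §5.3 [MazurRubin2004]; J. S. Milne, ADT I 2.8, 4.10 [MilneADT2006];
HOME/MEMO-es.md §15, §21, §25.2–25.3, §25.7; this folder's work/stubs/StubTestCocyclePkX9.notes.md (g5 wave 1).
-/

noncomputable section

open scoped Classical NumberField ContRepresentation
open WeierstrassCurve Field IsDedekindDomain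
open Literature.NumberTheory.GaloisRepresentations
open Literature.NumberTheory.GaloisCohomology
open Literature.NumberTheory.EllipticCurves
open Literature.NumberTheory.EllipticCurves.Kato2004
open Literature.NumberTheory.EllipticCurves.Kato2004.EulerSystemValues
open Summit.BirchSwinnertonDyer.BirchSwinnertonDyer.Rank1Residual
open Summit.BirchSwinnertonDyer.BirchSwinnertonDyer.Rank1Residual.CoreAssembly
open Summit.BirchSwinnertonDyer.BirchSwinnertonDyer.Theorems.OneSidedTwistSqueezeX9KatoDivisibilityX9GradedCoreAlgebra
open Summit.BirchSwinnertonDyer.Rank1Residual.SmallImageMu (FineCoreGradedOddPrime)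

namespace Summit.BirchSwinnertonDyer.BirchSwinnertonDyer.Theorems.OneSidedTwistSqueezeX9KatoDivisibilityX9GradedCoreAssemblyDefect

/-- **The graded core `SIM.FineCoreGradedOddPrime` from the four graded stubs of skeleton v4 and three published facts**
(`hred`: Kato §13.8; `hPT`: Poitou–Tate over `ℚ`; `hEP`: local Euler–Poincaré; `hBD`: test-pair supply with bounded defect;
`hG1`: level-`L` test cocycle at `p`-level `d+1`; `h12`: defect-tolerant Lemma 5.7.B + Chebotarev at `p`-level `d+1`;
`hG34`: Kolyvagin class + reciprocity over `Λ/(p^{d+1}, ω²)`).  [cite: Kato2004Asterisque, §13.3 and Thm. 12.4]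
[cite: MazurRubin2004, Prop. 1.3.2, §4.4, §5.3] -/
theorem fineCoreGraded_of_supply_of_testCocycle_of_kolyvaginPrime_of_reciprocity
    (hred : mem_pSmul_of_red_eq_zero)
    (hPT : poitouTate_sum_localTatePairing_eq_zero ℚ)
    (hEP : ∀ v : HeightOneSpectrum (𝓞 ℚ), localEulerPoincareCharacteristic (v.adicCompletion ℚ))
    (hBD : ∀ (W : WeierstrassCurve ℚ) [W.IsElliptic] [W.IsGloballyMinimal] (p : ℕ) [Fact p.Prime]
      (κ : ZpExtension ℚ p) (γ : absoluteGaloisGroup ℚ) (n d : ℕ), d ≤ n →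
      p ≠ 2 → W.HasIrreducibleModPGaloisRep p → ¬ W.HasSurjectiveModNGaloisRep p →
      κ.IsCyclotomic → κ.IsTopGenerator γ →
      ∃ δ₀ : ℕ, ∀ J : ℕ,
        (∃ y : Literature.NumberTheory.EllipticCurves.subgroupH1 κ.kerSubgroup (geomTorsion W (p : ℤ)),
          (∃ t : W.fineSelmerInfty κ,
            W.torsionToPrimaryH1Sub p κ.kerSubgroup y = p ^ n • (t : W.subgroupH1 p κ.kerSubgroup)) ∧
          (⇑(Literature.NumberTheory.EllipticCurves.conjH1 κ.kerSubgroup (geomTorsion W (p : ℤ)) γ -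
            AddMonoidHom.id (Literature.NumberTheory.EllipticCurves.subgroupH1 κ.kerSubgroup
              (geomTorsion W (p : ℤ)))))^[J] y ≠ 0) →
        ∃ y : Literature.NumberTheory.EllipticCurves.subgroupH1 κ.kerSubgroup (geomTorsion W (p : ℤ)),
          (∃ t : W.fineSelmerInfty κ,
            W.torsionToPrimaryH1Sub p κ.kerSubgroup y = p ^ d • (t : W.subgroupH1 p κ.kerSubgroup) ∧
            (⇑(W.conjH1 p κ.kerSubgroup γ - AddMonoidHom.id (W.subgroupH1 p κ.kerSubgroup)))^[J + 1 + δ₀]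
              (t : W.subgroupH1 p κ.kerSubgroup) = 0) ∧
          (⇑(Literature.NumberTheory.EllipticCurves.conjH1 κ.kerSubgroup (geomTorsion W (p : ℤ)) γ -
            AddMonoidHom.id (Literature.NumberTheory.EllipticCurves.subgroupH1 κ.kerSubgroup
              (geomTorsion W (p : ℤ)))))^[J] y ≠ 0)
    (hG1 : ∀ (W : WeierstrassCurve ℚ) [W.IsElliptic] [W.IsGloballyMinimal] (p : ℕ) [Fact p.Prime]
      (κ : ZpExtension ℚ p) (γ : absoluteGaloisGroup ℚ),
      p ≠ 2 → W.HasIrreducibleModPGaloisRep p → ¬ W.HasSurjectiveModNGaloisRep p →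
      κ.IsCyclotomic → κ.IsTopGenerator γ →
      (∀ v : HeightOneSpectrum (𝓞 ℚ), localEulerPoincareCharacteristic (v.adicCompletion ℚ)) →
      poitouTate_sum_localTatePairing_eq_zero ℚ →
      ∀ (d : ℕ)
        (ι : (W.torsionGaloisModule (p : ℤ)).toContRepresentation →ⁱL
          (W.torsionGaloisModule ((p : ℤ) ^ (d + 1))).toContRepresentation),
        (∀ P : geomTorsion W (p : ℤ),
          ((ι P : geomTorsion W ((p : ℤ) ^ (d + 1))) : geomPoints W) = (P : geomPoints W)) →
      ∀ (S₀ : Set (HeightOneSpectrum (𝓞 ℚ))), S₀.Finite →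
      ∃ (ε : ℕ) (S : Set (HeightOneSpectrum (𝓞 ℚ))), S.Finite ∧ S₀ ⊆ S ∧
        ∀ (L J : ℕ) (y : Literature.NumberTheory.EllipticCurves.subgroupH1 κ.kerSubgroup
            (geomTorsion W (p : ℤ))), J + 1 ≤ L →
          (∃ t : W.fineSelmerInfty κ,
            W.torsionToPrimaryH1Sub p κ.kerSubgroup y = p ^ d • (t : W.subgroupH1 p κ.kerSubgroup) ∧
            (⇑(W.conjH1 p κ.kerSubgroup γ - AddMonoidHom.id (W.subgroupH1 p κ.kerSubgroup)))^[L]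
              (t : W.subgroupH1 p κ.kerSubgroup) = 0) →
          (⇑(Literature.NumberTheory.EllipticCurves.conjH1 κ.kerSubgroup (geomTorsion W (p : ℤ)) γ -
            AddMonoidHom.id (Literature.NumberTheory.EllipticCurves.subgroupH1 κ.kerSubgroup
              (geomTorsion W (p : ℤ)))))^[J] y ≠ 0 →
          ∃ (Ψ : galoisCohomology (W.modPkTwist p (d + 1) κ.invTwist L) 1)
            (ψb : galoisCohomology (W.modPTwist p κ.invTwist L) 1),
            p ^ d • Ψ = galoisCohomology.map
              (κ.invTwist.twistModPToModPk (W.torsionGaloisModule (p : ℤ)) L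
                (W.torsionGaloisModule ((p : ℤ) ^ (d + 1)))
                (fun P : geomTorsion W (p : ℤ) => AddSubgroup.torsionBy.nsmul P)
                (W.pow_nsmul_geomTorsion_eq_zero p (d + 1)) ι) 1 ψb ∧
            (κ.invTwist.shiftH1 (W.torsionGaloisModule (p : ℤ))
                (fun P : geomTorsion W (p : ℤ) => AddSubgroup.torsionBy.nsmul P) L)^[J] ψb ≠ 0 ∧
            (∀ v : HeightOneSpectrum (𝓞 ℚ), v ∉ S →
              galoisCohomology.localization (W.modPkTwist p (d + 1) κ.invTwist L) (Sum.inr v) 1 Ψ ∈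
                DiscreteGaloisModule.unramifiedSubgroup
                  (GaloisRep.toLocal v (W.modPkTwist p (d + 1) κ.invTwist L)) 1) ∧
            (∀ v : HeightOneSpectrum (𝓞 ℚ), v ∈ S →
              galoisCohomology.localization (W.modPkTwist p (d + 1) κ.invTwist L) (Sum.inr v) 1
                (galoisCohomology.map
                  (κ.invTwist.twistModPkShiftEmbed (W.torsionGaloisModule ((p : ℤ) ^ (d + 1)))
                    (W.pow_nsmul_geomTorsion_eq_zero p (d + 1)) L (Nat.sub_le L ε)) 1
                  (galoisCohomology.map
                    (κ.invTwist.twistModPkTruncate (W.torsionGaloisModule ((p : ℤ) ^ (d + 1)))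
                      (W.pow_nsmul_geomTorsion_eq_zero p (d + 1)) L (Nat.sub_le L ε)) 1 Ψ)) = 0))
    (h12 : ∀ (W : WeierstrassCurve ℚ) [W.IsElliptic] [W.IsGloballyMinimal] (p : ℕ) [Fact p.Prime]
      (κ : ZpExtension ℚ p) (γ : absoluteGaloisGroup ℚ) (d δ : ℕ),
      p ≠ 2 → W.HasGoodReductionAtPrime p → ¬ ((p : ℤ) ∣ W.frobeniusTrace p) →
      W.HasIrreducibleModPGaloisRep p → ¬ W.HasSurjectiveModNGaloisRep p →
      κ.IsCyclotomic → κ.IsTopGenerator γ →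
      ∃ c₀ N₁ : ℕ, ∀ (N : ℕ), N₁ ≤ N → ∀ (e' : ℕ), e' + 1 = p ^ N →
        ∀ (κ' : κ.twistTower (W.torsionGaloisModule (p : ℤ))
            (fun P : geomTorsion W (p : ℤ) => AddSubgroup.torsionBy.nsmul P)),
          κ.towerConst (W.torsionGaloisModule (p : ℤ)) (fun P => AddSubgroup.torsionBy.nsmul P) κ' ≠ 0 →
        ∀ (φ : contOneCocycles (W.modPTwist p κ (e' + 1)).toTopRep),
          oneCocycleClass (W.modPTwist p κ (e' + 1)).toTopRep φ = κ'.1 (e' + 1) →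
        ∀ (ψ : contOneCocycles (W.modPTwist p κ.invTwist (e' + 1)).toTopRep),
          (κ.invTwist.shiftH1 (W.torsionGaloisModule (p : ℤ))
            (fun P : geomTorsion W (p : ℤ) => AddSubgroup.torsionBy.nsmul P) (e' + 1))^[e' - δ]
              (oneCocycleClass (W.modPTwist p κ.invTwist (e' + 1)).toTopRep ψ) ≠ 0 →
        ∀ (eW : geomTorsion W (p : ℤ) → geomTorsion W (p : ℤ) → AlgebraicClosure ℚ)
          (hμ : ∀ S T, eW S T ^ p = 1) (hadd₁ : ∀ S₁ S₂ T, eW (S₁ + S₂) T = eW S₁ T * eW S₂ T)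
          (hadd₂ : ∀ S T₁ T₂, eW S (T₁ + T₂) = eW S T₁ * eW S T₂),
          (∀ T, (∀ S, eW S T = 1) → T = 0) →
        ∀ (S : Set (HeightOneSpectrum (𝓞 ℚ))), S.Finite →
        ∃ q : HeightOneSpectrum (𝓞 ℚ), q ∉ S ∧ ∃ 𝔓 ∈ q.primesAbove, ∃ Fr : absoluteGaloisGroup ℚ,
          IsArithFrobAt (𝓞 ℚ) Fr 𝔓 ∧ galoisRepTorsion W ((p : ℤ) ^ (d + 1)) Fr = 1 ∧
          Fr ∈ κ.layerSubgroup N ∧ Fr ∉ κ.layerSubgroup (N + 1) ∧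
          ∃ j : ℕ, j ≤ c₀ + 1 ∧ j < e' + 1 ∧
            convCoeff (weilPairingHom W p eW hμ hadd₁ hadd₂) (e' + 1) j (φ.1 Fr) (ψ.1 Fr) ≠ 0)
    (hG34 : ∀ (W : WeierstrassCurve ℚ) [W.IsElliptic] [W.IsGloballyMinimal] (p : ℕ) [Fact p.Prime]
      [ContinuousSMul ℤ_[p] (W.tateModule p)] [Module.Free ℤ_[p] (W.tateModule p)]
      [Module.Finite ℤ_[p] (W.tateModule p)]
      (κ : ZpExtension ℚ p) (γ : absoluteGaloisGroup ℚ) (I : IwasawaH1Data W p κ γ),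
      p ≠ 2 → W.HasIrreducibleModPGaloisRep p → ¬ W.HasSurjectiveModNGaloisRep p →
      κ.IsCyclotomic → κ.IsTopGenerator γ →
      poitouTate_sum_localTatePairing_eq_zero ℚ →
      ∀ (s : I.H), IsEulerSystemClass W p κ γ I s →
      ∀ (d : ℕ) (s' : I.H), s = ((PowerSeries.C (p : ℤ_[p]) : IwasawaAlgebra p) ^ d) • s' →
      ∃ (S₀ : Set (HeightOneSpectrum (𝓞 ℚ))), S₀.Finite ∧
        ∀ (a : ℕ) (κ' : κ.twistTower (W.torsionGaloisModule (p : ℤ))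
            (fun P : geomTorsion W (p : ℤ) => AddSubgroup.torsionBy.nsmul P)),
          (κ.towerShift (W.torsionGaloisModule (p : ℤ))
              (fun P : geomTorsion W (p : ℤ) => AddSubgroup.torsionBy.nsmul P))^[a] κ' = I.redTower s' →
          ∀ (N e' : ℕ), e' + 1 = p ^ N → d ≤ N →
          ∀ (Φ : contOneCocycles (W.modPTwist p κ (2 * e' + 1 + 1)).toTopRep),
            oneCocycleClass (W.modPTwist p κ (2 * e' + 1 + 1)).toTopRep Φ = κ'.1 (2 * e' + 1 + 1) →
          ∀ (J : ℕ), J + 1 = (2 * e' + 1 + 1) * (d + 1) → ∀ (hJe : 2 * e' + 1 + 1 ≤ J + 1),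
          ∀ (ε : ℕ) (S₁ : Set (HeightOneSpectrum (𝓞 ℚ)))
            (ι : (W.torsionGaloisModule (p : ℤ)).toContRepresentation →ⁱL
              (W.torsionGaloisModule ((p : ℤ) ^ (d + 1))).toContRepresentation),
            (∀ P : geomTorsion W (p : ℤ),
              ((ι P : geomTorsion W ((p : ℤ) ^ (d + 1))) : geomPoints W) = (P : geomPoints W)) →
          ∀ (Ψ : galoisCohomology (W.modPkTwist p (d + 1) κ.invTwist (J + 1)) 1)
            (ψb : galoisCohomology (W.modPTwist p κ.invTwist (J + 1)) 1)
            (Ψc : contOneCocycles (W.modPTwist p κ.invTwist (2 * e' + 1 + 1)).toTopRep),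
            S₀ ⊆ S₁ →
            oneCocycleClass (W.modPTwist p κ.invTwist (2 * e' + 1 + 1)).toTopRep Ψc =
              κ.invTwist.truncH1 (W.torsionGaloisModule (p : ℤ))
                (fun P : geomTorsion W (p : ℤ) => AddSubgroup.torsionBy.nsmul P) hJe ψb →
            p ^ d • Ψ = galoisCohomology.map
              (κ.invTwist.twistModPToModPk (W.torsionGaloisModule (p : ℤ)) (J + 1)
                (W.torsionGaloisModule ((p : ℤ) ^ (d + 1)))
                (fun P : geomTorsion W (p : ℤ) => AddSubgroup.torsionBy.nsmul P)
                (W.pow_nsmul_geomTorsion_eq_zero p (d + 1)) ι) 1 ψb →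
            (∀ v : HeightOneSpectrum (𝓞 ℚ), v ∉ S₁ →
              galoisCohomology.localization (W.modPkTwist p (d + 1) κ.invTwist (J + 1)) (Sum.inr v) 1 Ψ ∈
                DiscreteGaloisModule.unramifiedSubgroup
                  (GaloisRep.toLocal v (W.modPkTwist p (d + 1) κ.invTwist (J + 1))) 1) →
            (∀ v : HeightOneSpectrum (𝓞 ℚ), v ∈ S₁ →
              galoisCohomology.localization (W.modPkTwist p (d + 1) κ.invTwist (J + 1)) (Sum.inr v) 1
                (galoisCohomology.map
                  (κ.invTwist.twistModPkShiftEmbed (W.torsionGaloisModule ((p : ℤ) ^ (d + 1)))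
                    (W.pow_nsmul_geomTorsion_eq_zero p (d + 1)) (J + 1) (Nat.sub_le (J + 1) ε)) 1
                  (galoisCohomology.map
                    (κ.invTwist.twistModPkTruncate (W.torsionGaloisModule ((p : ℤ) ^ (d + 1)))
                      (W.pow_nsmul_geomTorsion_eq_zero p (d + 1)) (J + 1) (Nat.sub_le (J + 1) ε)) 1 Ψ)) = 0) →
          ∀ (eW : geomTorsion W (p : ℤ) → geomTorsion W (p : ℤ) → AlgebraicClosure ℚ)
            (hμ : ∀ S T, eW S T ^ p = 1)
            (hadd₁ : ∀ S₁' S₂' T, eW (S₁' + S₂') T = eW S₁' T * eW S₂' T)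
            (hadd₂ : ∀ S T₁ T₂, eW S (T₁ + T₂) = eW S T₁ * eW S T₂),
            (∀ T, eW T T = 1) → (∀ T, (∀ S, eW S T = 1) → T = 0) →
            (∀ (σ : absoluteGaloisGroup ℚ) (S T : geomTorsion W (p : ℤ)), σ • eW S T = eW (σ • S) (σ • T)) →
          ∀ (q : HeightOneSpectrum (𝓞 ℚ)), q ∉ S₁ →
          ∀ 𝔓 ∈ q.primesAbove, ∀ (Fr : absoluteGaloisGroup ℚ), IsArithFrobAt (𝓞 ℚ) Fr 𝔓 →
            galoisRepTorsion W ((p : ℤ) ^ (d + 1)) Fr = 1 →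
            Fr ∈ κ.layerSubgroup N → Fr ∉ κ.layerSubgroup (N + 1) →
          ∃ U : Polynomial ℤ, ¬ ((p : ℤ) ∣ U.coeff 0) ∧
            ∀ i : ℕ, i + ε < 2 * e' + 1 + 1 →
              convCoeff (weilPairingHom W p eW hμ hadd₁ hadd₂) (2 * e' + 1 + 1) i
                (Polynomial.aeval (shiftEnd (geomTorsion W (p : ℤ)) (2 * e' + 1 + 1)) U
                  ((shiftEnd (geomTorsion W (p : ℤ)) (2 * e' + 1 + 1) ^ (e' + 1 + a)) (Φ.1 Fr)))
                (Ψc.1 Fr) = 0) :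
    FineCoreGradedOddPrime := by
  intro W _ _ p _ _ _ _ κ γ I n hp2 hgood hap hirr hns hκ hγ hs
  obtain ⟨s, hES, hsp⟩ := hs
  have hp : p.Prime := Fact.out
  haveI : Finite (geomTorsion W (p : ℤ)) :=
    WeierstrassCurve.finite_torsionPoints_holds W (AlgebraicClosure ℚ) (by exact_mod_cast hp.ne_zero)
  -- STEP 0ᵍ: `s = p^d s'`, `d ≤ n`, `s' ∉ p𝐇¹`; `red_Ω s' = T^a κ'`, `κ̄' ≠ 0`
  obtain ⟨d, hdn, s', hss', hs'p⟩ := exists_eq_C_pow_smul_and_not_mem hsp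
  have ht : I.redTower s' ≠ 0 := I.redTower_ne_zero_of_not_mem hred hκ hγ hs'p
  obtain ⟨a, κ', hκ'a, -, hκ'c⟩ :=
    LevelE.exists_towerShift_iterate_eq_and_towerConst_ne_zero W p κ hirr ht
  -- the inclusion `ι : E[p] ⊂ E[p^{d+1}]` as an equivariant continuous map
  have hle_tors : geomTorsion W (p : ℤ) ≤ geomTorsion W ((p : ℤ) ^ (d + 1)) := by
    intro P hP
    simp only [Submodule.mem_toAddSubgroup, Submodule.mem_torsionBy_iff] at hP ⊢
    rw [pow_succ, mul_smul, hP, smul_zero]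
  obtain ⟨ι, hι⟩ : ∃ ι : (W.torsionGaloisModule (p : ℤ)).toContRepresentation →ⁱL
      (W.torsionGaloisModule ((p : ℤ) ^ (d + 1))).toContRepresentation,
      ∀ P : geomTorsion W (p : ℤ),
        ((ι P : geomTorsion W ((p : ℤ) ^ (d + 1))) : geomPoints W) = (P : geomPoints W) := by
    refine ⟨{ toContinuousLinearMap :=
                { toFun := fun P => AddSubgroup.inclusion hle_tors P,
                  map_add' := fun P Q => map_add _ P Q,
                  map_smul' := fun c P => by rw [map_zsmul, RingHom.id_apply],
                  cont := continuous_of_discreteTopology },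
              isIntertwining' := fun g => ?_ }, fun P => rfl⟩
    refine ContinuousLinearMap.ext fun P => Subtype.ext ?_
    change (((W.torsionGaloisModule (p : ℤ)) g P : geomTorsion W (p : ℤ)) : geomPoints W) =
      (((W.torsionGaloisModule ((p : ℤ) ^ (d + 1))) g (AddSubgroup.inclusion hle_tors P) :
        geomTorsion W ((p : ℤ) ^ (d + 1))) : geomPoints W)
    simp only [torsionGaloisModule_apply_apply,
      Literature.NumberTheory.EllipticCurves.AddSubgroup.torsionBy.coe_smul, AddSubgroup.coe_inclusion]
  -- Steps 3–4ᵍ: the bad set `S₀` of the Euler system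
  obtain ⟨S₀, hS₀, hG34'⟩ := hG34 W p κ γ I hp2 hirr hns hκ hγ hPT s hES d s' hss'
  -- the Selmer sideᵍ at level `d`: `ε`, `S₁ ⊇ S₀`
  obtain ⟨ε, S₁, hS₁, hS₀₁, hG1'⟩ := hG1 W p κ γ hp2 hirr hns hκ hγ hEP hPT d ι hι S₀ hS₀
  -- the DEFECT BOUND `δ₀` of the test-pair supply (Artin–Rees on `X₀/p^{d+1}`)
  obtain ⟨δ₀, hBD'⟩ := hBD W p κ γ n d hdn hp2 hirr hns hκ hγ
  -- STEP 1+2ᵍ constants `c₀`, `N₁` (depending on the defect bound)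
  obtain ⟨c₀, N₁, h12'⟩ := h12 W p κ γ d δ₀ hp2 hgood hap hirr hns hκ hγ
  clear hBD hG1 h12 hG34
  -- a Weil pairing on `E[p]`
  obtain ⟨eW, hμ, hadd₁, hadd₂, halt, hnondeg, hgal⟩ :=
    W.exists_weilPairing_holds p hp.two_le (Nat.cast_ne_zero.mpr hp.ne_zero)
  -- suppose the conclusion fails: test classes of arbitrarily large `T`-order
  by_contra hcon
  push Not at hcon
  -- the level `e = e' + 1 = p^N`, `N ≥ N₁`, `N ≥ d`, `e > a + ε + c₀ + 1`
  set N : ℕ := a + ε + c₀ + 2 + N₁ + d + δ₀ with hN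
  have hlt : a + ε + c₀ + 2 + N₁ + d + δ₀ < p ^ N := Nat.lt_pow_self hp.one_lt
  obtain ⟨e', he⟩ : ∃ e' : ℕ, e' + 1 = p ^ N := ⟨p ^ N - 1, by omega⟩
  have he1 : 1 < e' + 1 := by
    have : p ≤ p ^ N := Nat.le_self_pow (by omega) p
    have := hp.two_le
    omega
  -- the big level `L = Jb + 1 = 2e·(d+1)` (so that `T^L ∈ (p^{d+1}, ω²)`) and the bad class `y` with `T^{Jb} y ≠ 0`,
  -- converted to a level-`d` test pair
  have hLpos : 1 ≤ (2 * e' + 1 + 1) * (d + 1) := Nat.one_le_iff_ne_zero.mpr (Nat.mul_ne_zero (by omega) (by omega))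
  obtain ⟨Jb, hJb⟩ : ∃ Jb : ℕ, Jb + 1 = (2 * e' + 1 + 1) * (d + 1) :=
    ⟨(2 * e' + 1 + 1) * (d + 1) - 1, Nat.sub_add_cancel hLpos⟩
  have hJe : 2 * e' + 1 + 1 ≤ Jb + 1 := by
    rw [hJb]
    exact Nat.le_mul_of_pos_right _ (by omega)
  -- the bad class at `T`-order `J₀ = Jb − δ₀`, re-supplied with a test partner of BOUNDED DEFECT (`T^{Jb+1} t = 0`)
  have hJ₀ : Jb - δ₀ + 1 + δ₀ = Jb + 1 := by omega
  obtain ⟨y, hyt', hyT⟩ := hBD' (Jb - δ₀) (hcon (Jb - δ₀))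
  rw [hJ₀] at hyt'
  obtain ⟨Ψ, ψb, hΨψ, hψT, hΨur, hΨε⟩ := hG1' (Jb + 1) (Jb - δ₀) y (by omega) hyt' hyT
  obtain ⟨ΨcL, hΨcL⟩ := oneCocycleClass_surjective _ ψb
  subst hΨcL
  -- the truncation `Ψc` of the mod-`p` class to level `2e`, of full `T`-order there
  let Ψc : contOneCocycles (W.modPTwist p κ.invTwist (2 * e' + 1 + 1)).toTopRep :=
    κ.invTwist.pushCocycle (W.torsionGaloisModule (p : ℤ))
      (fun P : geomTorsion W (p : ℤ) => AddSubgroup.torsionBy.nsmul P) (Jb + 1)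
      (κ.invTwist.twistModPTruncate (W.torsionGaloisModule (p : ℤ)) _ (Jb + 1) hJe) ΨcL
  have hΨcclass : oneCocycleClass (W.modPTwist p κ.invTwist (2 * e' + 1 + 1)).toTopRep Ψc =
      κ.invTwist.truncH1 (W.torsionGaloisModule (p : ℤ))
        (fun P : geomTorsion W (p : ℤ) => AddSubgroup.torsionBy.nsmul P) hJe
        (oneCocycleClass (W.modPTwist p κ.invTwist (Jb + 1)).toTopRep ΨcL) :=
    (ZpExtension.map_oneCocycleClass_twist κ.invTwist (W.torsionGaloisModule (p : ℤ)) _ (Jb + 1)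
      (κ.invTwist.twistModPTruncate (W.torsionGaloisModule (p : ℤ)) _ (Jb + 1) hJe) ΨcL).symm
  have hΨT2e : (κ.invTwist.shiftH1 (W.torsionGaloisModule (p : ℤ))
      (fun P : geomTorsion W (p : ℤ) => AddSubgroup.torsionBy.nsmul P) (2 * e' + 1 + 1))^[2 * e' + 1 - δ₀]
        (oneCocycleClass (W.modPTwist p κ.invTwist (2 * e' + 1 + 1)).toTopRep Ψc) ≠ 0 := by
    have h2e : δ₀ ≤ 2 * e' + 1 := by omega
    have h := shiftH1_iterate_truncate_ne_zero_of_le κ.invTwist (W.torsionGaloisModule (p : ℤ)) _ hJe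
      (k := Jb - δ₀) (by omega) ΨcL hψT
    rwa [show Jb - δ₀ - (Jb + 1 - (2 * e' + 1 + 1)) = 2 * e' + 1 - δ₀ by omega] at h
  -- a cocycle `Φ` of `κ'_{2e}`
  obtain ⟨Φ, hΦ⟩ := oneCocycleClass_surjective _ (κ'.1 (2 * e' + 1 + 1))
  -- truncations to level `e = e' + 1`
  have hle : e' + 1 ≤ 2 * e' + 1 + 1 := by omega
  let φ : contOneCocycles (W.modPTwist p κ (e' + 1)).toTopRep :=
    κ.pushCocycle (W.torsionGaloisModule (p : ℤ))
      (fun P : geomTorsion W (p : ℤ) => AddSubgroup.torsionBy.nsmul P) (2 * e' + 1 + 1)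
      (κ.twistModPTruncate (W.torsionGaloisModule (p : ℤ)) _ (2 * e' + 1 + 1) hle) Φ
  let ψ : contOneCocycles (W.modPTwist p κ.invTwist (e' + 1)).toTopRep :=
    κ.invTwist.pushCocycle (W.torsionGaloisModule (p : ℤ))
      (fun P : geomTorsion W (p : ℤ) => AddSubgroup.torsionBy.nsmul P) (2 * e' + 1 + 1)
      (κ.invTwist.twistModPTruncate (W.torsionGaloisModule (p : ℤ)) _ (2 * e' + 1 + 1) hle) Ψc
  have hφ : oneCocycleClass (W.modPTwist p κ (e' + 1)).toTopRep φ = κ'.1 (e' + 1) := by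
    have h1 := (κ.mem_twistTower_iff (W.torsionGaloisModule (p : ℤ)) _ κ'.1).1 κ'.2 _ _ hle
    rw [← hΦ] at h1
    exact (ZpExtension.map_oneCocycleClass_twist κ (W.torsionGaloisModule (p : ℤ)) _ (2 * e' + 1 + 1)
      (κ.twistModPTruncate (W.torsionGaloisModule (p : ℤ)) _ (2 * e' + 1 + 1) hle) Φ).symm.trans h1
  have hψT' : (κ.invTwist.shiftH1 (W.torsionGaloisModule (p : ℤ))
      (fun P : geomTorsion W (p : ℤ) => AddSubgroup.torsionBy.nsmul P) (e' + 1))^[e' - δ₀]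
        (oneCocycleClass (W.modPTwist p κ.invTwist (e' + 1)).toTopRep ψ) ≠ 0 := by
    have h := shiftH1_iterate_truncate_ne_zero_of_le κ.invTwist (W.torsionGaloisModule (p : ℤ)) _ hle
      (k := 2 * e' + 1 - δ₀) (by omega) Ψc hΨT2e
    rwa [show 2 * e' + 1 - δ₀ - (2 * e' + 1 + 1 - (e' + 1)) = e' - δ₀ by omega] at h
  -- STEP 1+2ᵍ (stub): an `E[p^{d+1}]`-split prime `q ∉ S₁` of depth `N` with a Frobenius at which a low
  -- convolution coefficient of `(φ, ψ)` does not vanish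
  haveI : NeZero p := ⟨hp.ne_zero⟩
  obtain ⟨q, hq, 𝔓, h𝔓, Fr, hFr, hFr1, hFrn, hFrn1, j, hjc, hje, hCj⟩ :=
    h12' N (by omega) e' he κ' hκ'c φ hφ ψ hψT' eW hμ hadd₁ hadd₂ hnondeg S₁ hS₁
  -- STEPS 3–4ᵍ (stub): the Kolyvagin class over `A` and reciprocity at `q`
  obtain ⟨U, hU0, hrec⟩ := hG34' a κ' hκ'a N e' he (by omega) Φ hΦ Jb hJb hJe ε S₁ ι hι Ψ _ Ψc hS₀₁
    hΨcclass hΨψ hΨur hΨε eW hμ hadd₁ hadd₂ halt hnondeg hgal q hq 𝔓 h𝔓 Fr hFr hFr1 hFrn hFrn1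
  -- the count with defect `c₀ + 1`: `C_j = 0` for all `j ≤ c₀ + 1` of the level-`2e` pair `(Φ(Fr), Ψc(Fr))`
  have hpC : ∀ c : DiscreteGaloisModule.MuCarrier ℚ p, (p : ℤ) • c = 0 :=
    natCast_zsmul_muCarrier_eq_zero ℚ p
  have hall := convCoeff_eq_zero_of_reciprocity_le (weilPairingHom W p eW hμ hadd₁ hadd₂) hp hpC
    (m := e' + 1 + a) (r := c₀ + 1) (ε := ε) (by omega) U hU0 (Φ.1 Fr) (Ψc.1 Fr) hrec
  have hCj0 : convCoeff (weilPairingHom W p eW hμ hadd₁ hadd₂) (2 * e' + 1 + 1) j (Φ.1 Fr) (Ψc.1 Fr) = 0 :=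
    hall j hjc
  -- the coefficients of index `< e` of the level-`2e` pair are those of the level-`e` pair `(φ(Fr), ψ(Fr))`
  have htr : convCoeff (weilPairingHom W p eW hμ hadd₁ hadd₂) (e' + 1) j (φ.1 Fr) (ψ.1 Fr) =
      convCoeff (weilPairingHom W p eW hμ hadd₁ hadd₂) (2 * e' + 1 + 1) j (Φ.1 Fr) (Ψc.1 Fr) :=
    convCoeff_eq_of_apply_castLE_eq (weilPairingHom W p eW hμ hadd₁ hadd₂) hle hje (Φ.1 Fr) (Ψc.1 Fr)
      (φ.1 Fr) (ψ.1 Fr) (fun _ => rfl) (fun _ => rfl)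
  exact hCj (htr.trans hCj0)

end Summit.BirchSwinnertonDyer.BirchSwinnertonDyer.Theorems.OneSidedTwistSqueezeX9KatoDivisibilityX9GradedCoreAssemblyDefect

end
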